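import Literature.MathematicalPhysics.KineticTheory.HarmonicChaosDecomposition
import HarnessLib

/-!
# Stub K2 `stub_wickShellStatic`, part III: lattice translations act on Wick products through their
coefficient data (line `gram-pencil-harmonic-chaos`, crux `EmbeddedDrudeMourre.DrudeDissolution`,
item stmt-AtomisticToContinuum-12593; `--supports` file, closes nothing; lead c11)

WHAT. For the shift `τ_y` of chain configurations (`chainShift y σ i = σ (i + y)`) and the translation of
coefficient data `τ_y g = (g^q_{· − y}, g^p_{· − y})` (`Finsupp.mapDomain (· + y)` on both components):
`φ(g) ∘ τ_y = φ(τ_y g)` (`linObs_comp_chainShift`), the thermal covariance is translation invariant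
(`thermalCov_shift_shift`), and hence Wick products are covariant: `:Π φ(g_i): ∘ τ_y = :Π φ(τ_y g_i):`
(`wick_comp_chainShift`, induction along Janson's recursion).
-/

noncomputable section

namespace Summit.AtomisticToContinuum.FouriersLaw.Theorems.DrudeDissolution.GramPencilHarmonicChaos

open MeasureTheory Filter Set Function Topology
open scoped InnerProductSpace ENNReal ComplexConjugate
open Literature.MathematicalPhysics.KineticTheory
open Literature.MathematicalPhysics.KineticTheory.HeatConduction
open HarmonicChaos ProbabilityTheory

/-- **Linear observables are shift covariant**: `φ(g)(τ_y σ) = φ(τ_y g)(σ)` with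
`τ_y g = (g^q ∘ (· − y), g^p ∘ (· − y))`. [folklore] -/
theorem linObs_comp_chainShift (g : TestFn) (y : ℤ) (σ : ChainConfig) :
    linObs g (chainShift y σ) =
      linObs (Finsupp.mapDomain (fun x : ℤ => x + y) g.1, Finsupp.mapDomain (fun x : ℤ => x + y) g.2) σ := by
  unfold linObs
  simp only
  rw [Finsupp.sum_mapDomain_index (fun _ => by simp) (fun _ _ _ => by ring),
    Finsupp.sum_mapDomain_index (fun _ => by simp) (fun _ _ _ => by ring)]
  simp only [chainShift_apply]

/-- **The thermal covariance is translation invariant**: `C_T(τ_y f, τ_y g) = C_T(f, g)`. [folklore] -/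
theorem thermalCov_shift_shift (ω₂ T : ℝ) (f g : TestFn) (y : ℤ) :
    thermalCov ω₂ T (Finsupp.mapDomain (fun x : ℤ => x + y) f.1, Finsupp.mapDomain (fun x : ℤ => x + y) f.2)
        (Finsupp.mapDomain (fun x : ℤ => x + y) g.1, Finsupp.mapDomain (fun x : ℤ => x + y) g.2) =
      thermalCov ω₂ T f g := by
  unfold thermalCov
  simp only
  congr 1
  congr 1
  · rw [Finsupp.sum_mapDomain_index (fun _ => by simp [Finsupp.sum])
      (fun b m₁ m₂ => by
        simp only [add_mul, Finsupp.sum]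
        rw [← Finset.sum_add_distrib])]
    refine Finsupp.sum_congr fun x _ => ?_
    rw [Finsupp.sum_mapDomain_index (fun _ => by simp) (fun _ _ _ => by ring)]
    refine Finsupp.sum_congr fun x' _ => ?_
    rw [show x + y - (x' + y) = x - x' by ring]
  · rw [Finsupp.sum_mapDomain_index (fun _ => by simp) (fun _ _ _ => by ring)]
    refine Finsupp.sum_congr fun x _ => ?_
    rw [Finsupp.mapDomain_apply (add_left_injective y)]

/-- **Wick products are shift covariant**: `:φ(g_0)⋯φ(g_{N-1}): ∘ τ_y = :φ(τ_y g_0)⋯φ(τ_y g_{N-1}):`.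
[cite: Janson1997, Thm 3.15] -/
theorem wick_comp_chainShift (ω₂ T : ℝ) (y : ℤ) :
    ∀ (N : ℕ) (g : Fin N → TestFn) (σ : ChainConfig),
      wick ω₂ T N g (chainShift y σ) =
        wick ω₂ T N (fun i => (Finsupp.mapDomain (fun x : ℤ => x + y) (g i).1,
          Finsupp.mapDomain (fun x : ℤ => x + y) (g i).2)) σ := by
  intro N
  induction N using Nat.twoStepInduction with
  | zero => intro g σ; rfl
  | one => intro g σ; exact linObs_comp_chainShift (g 0) y σ
  | more N ih0 ih1 =>
    intro g σ
    set g' : Fin (N + 2) → TestFn := fun i => (Finsupp.mapDomain (fun x : ℤ => x + y) (g i).1,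
      Finsupp.mapDomain (fun x : ℤ => x + y) (g i).2) with hg'
    show linObs (g 0) (chainShift y σ) * wick ω₂ T (N + 1) (Fin.tail g) (chainShift y σ) -
        ∑ i : Fin (N + 1), thermalCov ω₂ T (g 0) (g i.succ) *
          wick ω₂ T N (Fin.removeNth i (Fin.tail g)) (chainShift y σ) =
      linObs (g' 0) σ * wick ω₂ T (N + 1) (Fin.tail g') σ -
        ∑ i : Fin (N + 1), thermalCov ω₂ T (g' 0) (g' i.succ) *
          wick ω₂ T N (Fin.removeNth i (Fin.tail g')) σ
    rw [linObs_comp_chainShift (g 0), ih1 (Fin.tail g)]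
    simp_rw [ih0]
    congr 1
    refine Finset.sum_congr rfl fun i _ => ?_
    rw [hg']
    simp only
    rw [thermalCov_shift_shift ω₂ T (g 0) (g i.succ) y]
    rfl

end Summit.AtomisticToContinuum.FouriersLaw.Theorems.DrudeDissolution.GramPencilHarmonicChaos

end
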